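import Mathlib
import Literature.Computability.Complexity.FixedDimILPPolytope
import HarnessLib

/-!
# Lenstra's algorithm in fixed dimension, II: rounding a polytope by a simplex of maximal volume

Topic `Computability/Complexity`, grouping namespace `FixedDimILP`; sequel of
`FixedDimILPPolytope.lean`. Lenstra's algorithm first transforms the polytope `P = conv V` by an
affine map `τ` so that `τP` is "round": it contains a ball of radius `r` and lies in a ball of radius
`R` around the same centre, `R / r` depending on the dimension only (Lenstra 1983, §2; Schrijver 1986,
Thm. 15.6 does this by the ellipsoid method). For a FIXED dimension `N` the brute-force construction
of Lenstra 1983 §2 suffices and is what this file proves correct: take `N + 1` points `p₀, …, p_N` of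
the finite set `V` (the vertices) spanning a simplex of MAXIMAL VOLUME, and let `τ` send `pᵢ` to the
vertices of the standard simplex; then every `v ∈ V` has barycentric coordinates in `[-1, 1]`
(replacing `pᵢ` by `v` cannot increase the volume), so `τ(conv V)` lies in the cube-like set
`Q = {|yᵢ| ≤ 1, |1 - Σ yᵢ| ≤ 1}`, while `τ(conv V) ⊇` the standard simplex `⊇` a ball around its
centroid `g = (1/(N+1), …)`. In homogeneous coordinates `(1, x)` the volume is `|det H(p)| / N!` with
`H(p)` the matrix of rows `(1, pᵢ)`, and the barycentric coordinates of `x` are `(1, x) · H(p)⁻¹`.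

* `hom`, `homMat`, `bary` — homogeneous vectors, the homogeneous matrix of a tuple, barycentric
  coordinates; `hom_eq_bary_vecMul`, `sum_bary`, `eq_sum_bary_smul`, `bary_self`, affinity;
* `det_homMat_update` — replacing `pᵢ` by `x` multiplies `det H` by `bary p x i`;
* **`exists_maxVolume_tuple`** — if `conv V` contains a box around a point then some tuple of points of
  `V` has `det H ≠ 0` and all of `V` has barycentric coordinates in `[-1, 1]` (the maximal-volume one);
* `abs_bary_le_one_of_mem_convexHull` — then the same holds on `conv V`;
* `affineOf`, `bary_affineOf`, `mem_poly_affineOf` — the inverse chart `y ↦ p₀ + Σ yᵢ (pᵢ₊₁ - p₀)` and: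
  coordinates `y ≥ 0`, `Σ y ≤ 1` land in `poly sys` when the `pᵢ` do; `stdSimplex_of_near_centroid` —
  `|yᵢ - 1/(N+1)| ≤ 1/(N+1)²` for all `i` implies `y ≥ 0`, `Σ y ≤ 1` (the inscribed box).

All statements are coordinatewise (no norm is chosen here); file III converts to Euclidean balls.

## References

* H. W. Lenstra, Jr., *Integer programming with a fixed number of variables*, Math. Oper. Res. 8
  (1983) 538–548, §2 (constructing the simplex; "if one is satisfied with an algorithm that is only
  polynomial for fixed `n`", remark (b) p. 545). [LenstraHW1983]
* A. Schrijver, *Theory of Linear and Integer Programming*, Wiley 1986, §18.4 (Thm. 18.7, the rounding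
  step). [Schrijver1986]
-/

namespace Literature.Computability.Complexity

namespace FixedDimILP

open Set Matrix Finset

variable {N : ℕ}

/-! ### Homogeneous coordinates and barycentric coordinates -/

/-- The homogeneous vector `(1, x) ∈ ℝ^{N+1}` of `x ∈ ℝ^N`. [folklore] -/
def hom (x : Fin N → ℝ) : Fin (N + 1) → ℝ := Fin.cons 1 x

/-- `(1, x)₀ = 1`. [folklore] -/
@[simp] theorem hom_zero (x : Fin N → ℝ) : hom x 0 = 1 := rfl

/-- `(1, x)ᵢ₊₁ = xᵢ`. [folklore] -/
@[simp] theorem hom_succ (x : Fin N → ℝ) (i : Fin N) : hom x i.succ = x i := by simp [hom]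

/-- `hom` is injective. [folklore] -/
theorem hom_injective : Function.Injective (hom (N := N)) := fun x y h => by
  funext i; simpa using congrFun h i.succ

/-- The homogeneous vector of an affine combination (weights summing to `1`) is the combination of
the homogeneous vectors. [folklore] -/
theorem hom_affineCombination {ι : Type} (s : Finset ι) (w : ι → ℝ) (z : ι → Fin N → ℝ) (hw : ∑ i ∈ s, w i = 1) :
    hom (∑ i ∈ s, w i • z i) = ∑ i ∈ s, w i • hom (z i) := by
  funext k
  refine Fin.cases ?_ (fun j => ?_) k
  · simp [hom, Finset.sum_apply, hw]
  · simp [hom, Finset.sum_apply]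

/-- The HOMOGENEOUS MATRIX of a tuple `p₀, …, p_N ∈ ℝ^N`: rows `(1, pᵢ)`; `|det| / N!` is the volume of
the simplex `conv {pᵢ}`. [cite: LenstraHW1983, §2 (volumes of simplices)] -/
def homMat (p : Fin (N + 1) → Fin N → ℝ) : Matrix (Fin (N + 1)) (Fin (N + 1)) ℝ :=
  Matrix.of fun i => hom (p i)

/-- Rows of the homogeneous matrix. [folklore] -/
@[simp] theorem homMat_apply (p : Fin (N + 1) → Fin N → ℝ) (i : Fin (N + 1)) : homMat p i = hom (p i) := rfl

/-- Replacing a point replaces a row. [folklore] -/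
theorem homMat_update (p : Fin (N + 1) → Fin N → ℝ) (i : Fin (N + 1)) (x : Fin N → ℝ) :
    homMat (Function.update p i x) = (homMat p).updateRow i (hom x) := by
  ext k l
  by_cases h : k = i
  · subst h; simp [homMat, updateRow_self]
  · simp [homMat, updateRow_ne h, Function.update_of_ne h]

/-- BARYCENTRIC COORDINATES of `x` with respect to the tuple `p`: the row vector `(1, x) · H(p)⁻¹`
(junk unless `det H(p) ≠ 0`). [cite: LenstraHW1983, §2] -/
noncomputable def bary (p : Fin (N + 1) → Fin N → ℝ) (x : Fin N → ℝ) : Fin (N + 1) → ℝ :=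
  hom x ᵥ* (homMat p)⁻¹

/-- `(1, x) = bary · H(p)`: the homogeneous vector is the barycentric combination of the rows.
[folklore] -/
theorem hom_eq_bary_vecMul {p : Fin (N + 1) → Fin N → ℝ} (hp : (homMat p).det ≠ 0) (x : Fin N → ℝ) :
    hom x = bary p x ᵥ* homMat p := by
  rw [bary, vecMul_vecMul, nonsing_inv_mul _ (isUnit_iff_ne_zero.2 hp), vecMul_one]

/-- `(1, x) = Σᵢ baryᵢ (1, pᵢ)`. [folklore] -/
theorem hom_eq_sum_bary_smul {p : Fin (N + 1) → Fin N → ℝ} (hp : (homMat p).det ≠ 0) (x : Fin N → ℝ) :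
    hom x = ∑ i, bary p x i • hom (p i) := by
  rw [hom_eq_bary_vecMul hp x, vecMul_eq_sum]; rfl

/-- **The barycentric coordinates sum to `1`.** [folklore] -/
theorem sum_bary {p : Fin (N + 1) → Fin N → ℝ} (hp : (homMat p).det ≠ 0) (x : Fin N → ℝ) :
    ∑ i, bary p x i = 1 := by
  have h := congrFun (hom_eq_sum_bary_smul hp x) 0
  simp only [hom_zero, Finset.sum_apply, Pi.smul_apply, smul_eq_mul, mul_one] at h
  exact h.symm

/-- **`x` is the barycentric combination of the points**: `x = Σᵢ baryᵢ pᵢ`. [folklore] -/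
theorem eq_sum_bary_smul {p : Fin (N + 1) → Fin N → ℝ} (hp : (homMat p).det ≠ 0) (x : Fin N → ℝ) :
    x = ∑ i, bary p x i • p i := by
  funext j
  have h := congrFun (hom_eq_sum_bary_smul hp x) j.succ
  simp only [hom_succ, Finset.sum_apply, Pi.smul_apply, smul_eq_mul] at h
  rw [h, Finset.sum_apply]
  simp

/-- Barycentric coordinates are determined by `(1, x) = w · H(p)`. [folklore] -/
theorem bary_eq_of_hom_eq_vecMul {p : Fin (N + 1) → Fin N → ℝ} (hp : (homMat p).det ≠ 0) {x : Fin N → ℝ}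
    {w : Fin (N + 1) → ℝ} (h : hom x = w ᵥ* homMat p) : bary p x = w := by
  rw [bary, h, vecMul_vecMul, mul_nonsing_inv _ (isUnit_iff_ne_zero.2 hp), vecMul_one]

/-- The points themselves have unit barycentric coordinates. [folklore] -/
theorem bary_self {p : Fin (N + 1) → Fin N → ℝ} (hp : (homMat p).det ≠ 0) (j : Fin (N + 1)) :
    bary p (p j) = Pi.single j 1 :=
  bary_eq_of_hom_eq_vecMul hp (by rw [single_one_vecMul]; rfl)

/-- **Barycentric coordinates are affine**: for weights summing to `1`,
`bary (Σ wₖ zₖ) = Σ wₖ bary zₖ`. [folklore] -/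
theorem bary_affineCombination {p : Fin (N + 1) → Fin N → ℝ} {ι : Type} (s : Finset ι) (w : ι → ℝ)
    (z : ι → Fin N → ℝ) (hw : ∑ k ∈ s, w k = 1) :
    bary p (∑ k ∈ s, w k • z k) = ∑ k ∈ s, w k • bary p (z k) := by
  rw [bary, hom_affineCombination s w z hw, sum_vecMul]
  refine Finset.sum_congr rfl fun k _ => ?_
  rw [smul_vecMul]; rfl

/-- **Replacing `pᵢ` by `x` multiplies the determinant by `bary p x i`** (multilinearity: the new row
`(1, x) = Σⱼ baryⱼ (1, pⱼ)`, and the terms `j ≠ i` repeat a row). This is why a tuple of MAXIMAL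
`|det H|` has all barycentric coordinates of `V` in `[-1, 1]`. [cite: LenstraHW1983, §2 (maximal simplex)] -/
theorem det_homMat_update {p : Fin (N + 1) → Fin N → ℝ} (hp : (homMat p).det ≠ 0) (i : Fin (N + 1))
    (x : Fin N → ℝ) : (homMat (Function.update p i x)).det = bary p x i * (homMat p).det := by
  rw [homMat_update, hom_eq_sum_bary_smul hp x]
  have : (∑ j, bary p x j • hom (p j)) = ∑ j, bary p x j • homMat p j := rfl
  rw [this, det_updateRow_sum, smul_eq_mul]

/-! ### A tuple of maximal volume rounds the polytope -/

/-- If the convex hull of `V` contains a box then the homogeneous vectors `(1, v)`, `v ∈ V`, span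
`ℝ^{N+1}` (a non-zero affine function cannot vanish on a box). [cite: LenstraHW1983, §2] -/
theorem span_hom_eq_top {V : Set (Fin N → ℝ)} {x₀ : Fin N → ℝ} {ρ : ℝ} (hρ : 0 < ρ)
    (hbox : ∀ y : Fin N → ℝ, (∀ j, |y j - x₀ j| ≤ ρ) → y ∈ convexHull ℝ V) :
    Submodule.span ℝ (hom '' V) = ⊤ := by
  by_contra htop
  obtain ⟨f, hf0, hker⟩ := Submodule.exists_le_ker_of_lt_top _ (lt_top_iff_ne_top.2 htop)
  -- `f` vanishes on `hom v`, `v ∈ V`, hence on `hom y` for `y ∈ conv V` (affine in `y`)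
  have hV : ∀ v ∈ V, f (hom v) = 0 := fun v hv =>
    LinearMap.mem_ker.1 (hker (Submodule.subset_span ⟨v, hv, rfl⟩))
  have hconv : ∀ y ∈ convexHull ℝ V, f (hom y) = 0 := by
    intro y hy
    have hC : Convex ℝ {y : Fin N → ℝ | f (hom y) = 0} := by
      intro a ha b hb s t _ _ hst
      simp only [Set.mem_setOf_eq] at ha hb ⊢
      have : hom (s • a + t • b) = s • hom a + t • hom b := by
        have h := hom_affineCombination (ι := Bool) Finset.univ (fun c => if c then s else t)
          (fun c => if c then a else b) (by simp [hst])
        simpa using h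
      rw [this, map_add, map_smul, map_smul, ha, hb, smul_zero, smul_zero, add_zero]
    exact (convexHull_min (fun v hv => hV v hv) hC) hy
  -- the box around `x₀`: evaluate at `x₀` and at `x₀ + ρ eⱼ`
  have hx₀ : f (hom x₀) = 0 := hconv x₀ (hbox x₀ fun j => by simp [hρ.le])
  have hej : ∀ j : Fin N, f (Pi.single j.succ 1) = 0 := by
    intro j
    have hy : f (hom (x₀ + ρ • Pi.single j 1)) = 0 := hconv _ (hbox _ fun k => by
      by_cases hk : k = j
      · subst hk; simp [abs_of_pos hρ]
      · simp [hk, hρ.le])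
    have hsplit : hom (x₀ + ρ • Pi.single j 1) = hom x₀ + ρ • Pi.single j.succ 1 := by
      funext k
      refine Fin.cases ?_ (fun l => ?_) k
      · simp [hom]
      · simp [hom, Pi.single_apply, Fin.succ_inj]
    rw [hsplit, map_add, map_smul, hx₀, zero_add, smul_eq_mul] at hy
    exact (mul_eq_zero.1 hy).resolve_left hρ.ne'
  have he0 : f (Pi.single 0 1) = 0 := by
    have hsplit : hom x₀ = Pi.single 0 1 + ∑ j : Fin N, x₀ j • Pi.single j.succ 1 := by
      funext k
      refine Fin.cases ?_ (fun l => ?_) k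
      · simp [hom, Finset.sum_apply, Fin.succ_ne_zero]
      · simp [hom, Finset.sum_apply, Pi.single_apply, Fin.succ_inj]
    have := hx₀
    rw [hsplit, map_add, map_sum] at this
    simpa [hej] using this
  apply hf0
  apply LinearMap.ext
  intro z
  rw [LinearMap.pi_apply_eq_sum_univ f z, LinearMap.zero_apply]
  refine Finset.sum_eq_zero fun k _ => ?_
  have hk : (fun l => if k = l then (1 : ℝ) else 0) = Pi.single k 1 := by
    funext l; simp [Pi.single_apply, eq_comm]
  rw [hk]
  refine Fin.cases ?_ (fun j => ?_) k
  · rw [he0, smul_zero]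
  · rw [hej, smul_zero]

/-- Hence some `N + 1` points of `V` have a nonsingular homogeneous matrix (an affinely independent
`(N+1)`-subset). [cite: LenstraHW1983, §2] -/
theorem exists_det_homMat_ne_zero {V : Set (Fin N → ℝ)} {x₀ : Fin N → ℝ} {ρ : ℝ} (hρ : 0 < ρ)
    (hbox : ∀ y : Fin N → ℝ, (∀ j, |y j - x₀ j| ≤ ρ) → y ∈ convexHull ℝ V) :
    ∃ p : Fin (N + 1) → Fin N → ℝ, (∀ i, p i ∈ V) ∧ (homMat p).det ≠ 0 := by
  classical
  have hspan := span_hom_eq_top hρ hbox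
  obtain ⟨b, hbT, hbspan, hbli⟩ := exists_linearIndependent ℝ (hom '' V)
  have hbspan' : Submodule.span ℝ b = ⊤ := by rw [hbspan, hspan]
  haveI : Fintype b := (LinearIndependent.setFinite hbli).fintype
  let B : Module.Basis b ℝ (Fin (N + 1) → ℝ) := Module.Basis.mk hbli (by rw [Subtype.range_coe, hbspan'])
  have hcard : Fintype.card b = N + 1 := by
    have h := Module.finrank_eq_card_basis B
    rw [Module.finrank_fin_fun] at h
    exact h.symm
  let e : Fin (N + 1) ≃ b := (Fintype.equivFinOfCardEq hcard).symm
  have hpt : ∀ i : Fin (N + 1), ∃ v ∈ V, hom v = (e i : Fin (N + 1) → ℝ) := fun i => hbT (e i).2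
  choose p hp using hpt
  refine ⟨p, fun i => (hp i).1, ?_⟩
  have hli : LinearIndependent ℝ (fun i => hom (p i)) := by
    have : (fun i => hom (p i)) = (fun v : b => (v : Fin (N + 1) → ℝ)) ∘ e := funext fun i => (hp i).2
    rw [this]
    exact hbli.comp _ e.injective
  have hunit : IsUnit (homMat p) := Matrix.linearIndependent_rows_iff_isUnit.1 hli
  exact ((Matrix.isUnit_iff_isUnit_det _).1 hunit).ne_zero

/-- **The maximal-volume simplex** (Lenstra 1983, §2): if the convex hull of a FINITE set `V` contains
a box, some tuple `p` of points of `V` has `det H(p) ≠ 0` and every `v ∈ V` has all barycentric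
coordinates with respect to `p` in `[-1, 1]` — namely a tuple maximising `|det H|`: replacing `pᵢ` by
`v` gives `|bary p v i| · |det H(p)| = |det H(p[i ↦ v])| ≤ |det H(p)|`. [cite: LenstraHW1983, §2 (a simplex of maximal volume)] [cite: Schrijver1986, Thm. 18.7 (rounding step)] -/
theorem exists_maxVolume_tuple {V : Finset (Fin N → ℝ)} {x₀ : Fin N → ℝ} {ρ : ℝ} (hρ : 0 < ρ)
    (hbox : ∀ y : Fin N → ℝ, (∀ j, |y j - x₀ j| ≤ ρ) → y ∈ convexHull ℝ (V : Set (Fin N → ℝ))) :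
    ∃ p : Fin (N + 1) → Fin N → ℝ, (∀ i, p i ∈ V) ∧ (homMat p).det ≠ 0 ∧
      ∀ v ∈ V, ∀ i, |bary p v i| ≤ 1 := by
  classical
  obtain ⟨p₁, hp₁V, hp₁⟩ := exists_det_homMat_ne_zero hρ hbox
  haveI : Nonempty V := ⟨⟨p₁ 0, hp₁V 0⟩⟩
  -- maximise `|det H|` over the finite type of tuples of elements of `V`
  obtain ⟨q, hq⟩ := Finite.exists_max fun q : Fin (N + 1) → V => |(homMat fun i => (q i : Fin N → ℝ)).det|
  set p : Fin (N + 1) → Fin N → ℝ := fun i => (q i : Fin N → ℝ) with hpdef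
  have hge : |(homMat p₁).det| ≤ |(homMat p).det| := hq fun i => ⟨p₁ i, hp₁V i⟩
  have hp : (homMat p).det ≠ 0 := fun h => hp₁ (abs_eq_zero.1 (le_antisymm (by rw [h, abs_zero] at hge; exact hge) (abs_nonneg _)))
  refine ⟨p, fun i => (q i).2, hp, fun v hv i => ?_⟩
  have hle : |(homMat (Function.update p i v)).det| ≤ |(homMat p).det| := by
    have := hq (Function.update q i ⟨v, hv⟩)
    have hfun : (fun j => ((Function.update q i ⟨v, hv⟩ j : V) : Fin N → ℝ)) = Function.update p i v := by
      funext j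
      by_cases hj : j = i
      · subst hj; simp [hpdef]
      · simp [Function.update_of_ne hj, hpdef]
    rw [hfun] at this
    exact this
  rw [det_homMat_update hp, abs_mul] at hle
  have hpos : 0 < |(homMat p).det| := abs_pos.2 hp
  nlinarith

/-- The barycentric bounds pass to the convex hull (barycentric coordinates are affine).
[cite: LenstraHW1983, §2] -/
theorem abs_bary_le_one_of_mem_convexHull {V : Set (Fin N → ℝ)} {p : Fin (N + 1) → Fin N → ℝ}
    (hV : ∀ v ∈ V, ∀ i, |bary p v i| ≤ 1) {x : Fin N → ℝ} (hx : x ∈ convexHull ℝ V) (i : Fin (N + 1)) :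
    |bary p x i| ≤ 1 := by
  have hC : Convex ℝ {y : Fin N → ℝ | ∀ i, |bary p y i| ≤ 1} := by
    intro a ha b hb s t hs ht hst j
    simp only [Set.mem_setOf_eq] at ha hb ⊢
    have : bary p (s • a + t • b) = s • bary p a + t • bary p b := by
      have h := bary_affineCombination (p := p) (ι := Bool) Finset.univ (fun c => if c then s else t)
        (fun c => if c then a else b) (by simp [hst])
      simpa using h
    rw [this, Pi.add_apply, Pi.smul_apply, Pi.smul_apply, smul_eq_mul, smul_eq_mul]
    calc |s * bary p a j + t * bary p b j| ≤ |s * bary p a j| + |t * bary p b j| := abs_add_le _ _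
      _ = s * |bary p a j| + t * |bary p b j| := by rw [abs_mul, abs_mul, abs_of_nonneg hs, abs_of_nonneg ht]
      _ ≤ s * 1 + t * 1 := add_le_add (mul_le_mul_of_nonneg_left (ha j) hs) (mul_le_mul_of_nonneg_left (hb j) ht)
      _ = 1 := by rw [mul_one, mul_one, hst]
  exact (convexHull_min (fun v hv => hV v hv) hC) hx i

/-! ### The chart of the simplex and the inscribed box -/

/-- The affine chart of the tuple: `y ↦ p₀ + Σᵢ yᵢ (pᵢ₊₁ - p₀)` (so `y = (bary₁, …, bary_N)`).
[cite: LenstraHW1983, §2 (the transformation `τ`)] -/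
def affineOf (p : Fin (N + 1) → Fin N → ℝ) (y : Fin N → ℝ) : Fin N → ℝ :=
  p 0 + ∑ i, y i • (p i.succ - p 0)

/-- The chart is the affine combination with weights `(1 - Σ y, y₁, …, y_N)`. [folklore] -/
theorem affineOf_eq_sum (p : Fin (N + 1) → Fin N → ℝ) (y : Fin N → ℝ) :
    affineOf p y = ∑ i, (Fin.cons (1 - ∑ j, y j) y : Fin (N + 1) → ℝ) i • p i := by
  rw [Fin.sum_univ_succ, affineOf]
  simp only [Fin.cons_zero, Fin.cons_succ, smul_sub, Finset.sum_sub_distrib, ← Finset.sum_smul]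
  module

/-- **Barycentric coordinates of the chart**: `bary p (affineOf p y) = (1 - Σ y, y)`. [folklore] -/
theorem bary_affineOf {p : Fin (N + 1) → Fin N → ℝ} (hp : (homMat p).det ≠ 0) (y : Fin N → ℝ) :
    bary p (affineOf p y) = Fin.cons (1 - ∑ j, y j) y := by
  apply bary_eq_of_hom_eq_vecMul hp
  have hw : ∑ i, (Fin.cons (1 - ∑ j, y j) y : Fin (N + 1) → ℝ) i = 1 := by
    rw [Fin.sum_univ_succ]; simp
  rw [affineOf_eq_sum, hom_affineCombination _ _ _ hw, vecMul_eq_sum]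
  rfl

/-- **Points with nonnegative barycentric coordinates lie in every polyhedron containing the tuple**
(they are convex combinations of the `pᵢ`). [folklore] -/
theorem mem_poly_of_bary_nonneg {sys : RealSys N} {p : Fin (N + 1) → Fin N → ℝ} (hp : (homMat p).det ≠ 0)
    (hpi : ∀ i, p i ∈ poly sys) {x : Fin N → ℝ} (hx : ∀ i, 0 ≤ bary p x i) : x ∈ poly sys := by
  intro r hr
  rw [eq_sum_bary_smul hp x, dotProduct_sum]
  calc ∑ i, r.1 ⬝ᵥ (bary p x i • p i) = ∑ i, bary p x i * (r.1 ⬝ᵥ p i) := by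
        refine Finset.sum_congr rfl fun i _ => ?_; rw [dotProduct_smul, smul_eq_mul]
    _ ≤ ∑ i, bary p x i * r.2 := Finset.sum_le_sum fun i _ => mul_le_mul_of_nonneg_left (hpi i r hr) (hx i)
    _ = r.2 := by rw [← Finset.sum_mul, sum_bary hp, one_mul]

/-- Chart points with `y ≥ 0`, `Σ y ≤ 1` lie in every polyhedron containing the tuple. [folklore] -/
theorem affineOf_mem_poly {sys : RealSys N} {p : Fin (N + 1) → Fin N → ℝ} (hp : (homMat p).det ≠ 0)
    (hpi : ∀ i, p i ∈ poly sys) {y : Fin N → ℝ} (hy : ∀ i, 0 ≤ y i) (hsum : ∑ i, y i ≤ 1) :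
    affineOf p y ∈ poly sys := by
  refine mem_poly_of_bary_nonneg hp hpi fun i => ?_
  rw [bary_affineOf hp]
  refine Fin.cases ?_ (fun j => ?_) i
  · simp only [Fin.cons_zero]; linarith
  · simp only [Fin.cons_succ]; exact hy j

/-- **The inscribed box**: coordinates within `1/(N+1)²` of the centroid `(1/(N+1), …, 1/(N+1))` of the
standard simplex are nonnegative with sum at most `1`. [cite: LenstraHW1983, §2 (the ball inside the simplex)] -/
theorem stdSimplex_of_near_centroid {y : Fin N → ℝ}
    (hy : ∀ i, |y i - 1 / (N + 1)| ≤ 1 / ((N : ℝ) + 1) ^ 2) : (∀ i, 0 ≤ y i) ∧ ∑ i, y i ≤ 1 := by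
  have hN : (0 : ℝ) < (N : ℝ) + 1 := by positivity
  have hkey : 1 / ((N : ℝ) + 1) ^ 2 ≤ 1 / ((N : ℝ) + 1) := by
    rw [one_div_le_one_div (by positivity) hN]
    nlinarith
  constructor
  · intro i
    have := (abs_le.1 (hy i)).1
    linarith
  · calc ∑ i, y i ≤ ∑ _i : Fin N, (1 / ((N : ℝ) + 1) + 1 / ((N : ℝ) + 1) ^ 2) :=
          Finset.sum_le_sum fun i _ => by have := (abs_le.1 (hy i)).2; linarith
      _ = N * (1 / ((N : ℝ) + 1) + 1 / ((N : ℝ) + 1) ^ 2) := by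
          rw [Finset.sum_const, Finset.card_univ, Fintype.card_fin, nsmul_eq_mul]
      _ ≤ 1 := by
          rw [div_add_div _ _ hN.ne' (by positivity), mul_div_assoc', div_le_one (by positivity)]
          nlinarith

/-- **The circumscribed box**: barycentric bounds `|baryᵢ| ≤ 1` put every chart coordinate within `2`
of the centroid coordinate `1/(N+1)`. [cite: LenstraHW1983, §2 (the ball around the simplex)] -/
theorem abs_sub_centroid_le_two {p : Fin (N + 1) → Fin N → ℝ} {x : Fin N → ℝ} (hx : ∀ i, |bary p x i| ≤ 1)
    (j : Fin N) : |bary p x j.succ - 1 / ((N : ℝ) + 1)| ≤ 2 := by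
  have h1 := abs_le.1 (hx j.succ)
  have h2 : (0 : ℝ) ≤ 1 / ((N : ℝ) + 1) := by positivity
  have h3 : 1 / ((N : ℝ) + 1) ≤ 1 := by rw [div_le_one (by positivity)]; linarith
  rw [abs_le]; constructor <;> linarith

end FixedDimILP

end Literature.Computability.Complexity
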